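import Summits.NavierStokesRegularity.NavierStokesRegularity.Theorems.WakeRatchetEternalInviscidRateBackscatterBudget

/-!
# Conveyor ledger (crux `WakeRatchet.EternalInviscidRate`, ⟨stmt-NavierStokesRegularity-25646⟩) —
# BOTH ledger defects at a bond (conveyor mass AND sloshing lift) are controlled by ONE quantity: peak × action

Helpers for the open stubs `stub_noSloshing` / `stub_noConveyor` of the registered skeleton «conveyor ledger» (LINE g10-3, sha16
d183ebc25b56, namespace `…Cruxes.EternalInviscidRate.FinalWakeLedger`) and for the planners' prepared BLOCK re-typing (LINE g11-2,
stub `boundedSloshing : ∃ ℓ`).  MODEL lattice only (Tao 2016 §4 renormalised cascade); nothing here is a statement about the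
Navier–Stokes equations, no stub is closed by name, no summit is proved by this file.

For a uniformly bounded admissible INVISCID eternal solution `W` of a cancelling table, with final tails `L` (landed `stub_tailLimit`),
a single-shell peak bound `E_n(σ) ≤ S` and an action bound `∫_ℝ ‖W_{n+1}‖ ≤ A` (write `c := 2C_AΛ⁻¹`):
* `backscatter_le_peak_action` — the TOTAL BACKSCATTER through bond `n` is at most `c·S·A`: `∫_ℝ max(−F_n, 0) ≤ c S A`
  (pointwise `|F_n| ≤ c S ‖W_{n+1}‖`, landed `abs_physFlux_le_peak`).
* `tail_le_finalTail_add_peak_action` — hence the tail above `n+1` never overshoots its final value by more than `c S A`: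
  `T_{n+1}(σ) ≤ L (n+1) + c S A` (with the landed `tail_le_finalTail_add_backscatter`).  The SLOSHING LIFT is an ABSOLUTE quantity
  bounded by `peak(n) × action(n+1)` — exactly the quantity that bounds the conveyor mass (landed `conveyorMass_le_of_peak`):
* `ledgerDefects_le_peak_action` — with the uniform action bound `M` of `IsEternal`, BOTH defects of the conveyor ledger at bond `n`
  are `≤ c·M·S`: the conveyor mass `m` and the lift `T_{n+1}(σ) − L(n+1)` for every `σ`.  So g0's residual of `stub_noConveyor`
  («peaks fade along some shells», `noConveyor_of_peaks_fade`) ALSO kills sloshing, absolutely, along the same shells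
  (`sloshing_fade_of_peaks_fade`).
* `boundedSloshing_of_relativePeak` — the block line's `∃ ℓ` sloshing stub REDUCED to a RELATIVE PEAK BOUND: if the peak of shell `n`
  is at most `K` times the energy that finally settles above it, `S ≤ K · L(n+1)`, then `T_{n+1}(σ) ≤ (1 + c K A) · L(n+1)` for all `σ`
  (`(1+ε₀)^ℓ := 1 + cKA`); `noSloshing_of_relativePeak` is the `NoSloshing R γ` form (`1 + cKA ≤ (1+ε₀)^γ`).  On period-1 DSS fronts
  `S/L(n+1)` is a shell-independent shape constant (landed lift-ratio rung), so the relative peak bound is the honest content there;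
  the typed budget `γ = 1/6` asks `cKA ≤ (1+ε₀)^{1/6} − 1 → 0`, which no fixed front shape meets as `ε₀ → 0` (cf. E-g10-2 lifts).
[cite: Tao2016AveragedNS, §4 Lemma 4.1 (4.8)–(4.10) with the cancellation (4.3), in the self-similar variables of §6.4]
-/

noncomputable section

set_option linter.dupNamespace false

open Filter Topology Set MeasureTheory
open Literature.Analysis.FluidPDE Literature.Analysis.FluidPDE.TaoCascade
open Summit.NavierStokesRegularity.NavierStokesRegularity.Theorems

namespace Summit.NavierStokesRegularity.NavierStokesRegularity.Cruxes.EternalInviscidRate.FinalWakeLedger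

variable {ε₀ : ℝ} {α : Fin 4 → Fin 4 → Fin 4 → ℤ × ℤ × ℤ → ℝ} {W : ℤ → ℝ → Em 4}

/-- **Total backscatter ≤ peak × action.**  If `E_n(σ) ≤ S` at all log-times and `∫_ℝ ‖W_{n+1}‖ ≤ A`, then the total backward
transfer through bond `n` obeys `∫_ℝ max(−F_n, 0) ≤ 2C_AΛ⁻¹ · S · A`. -/
theorem backscatter_le_peak_action (hε : 0 < ε₀) (hc : IsCancellingCoeff α) (hW : IsEternal ε₀ α W)
    (hU : UniformBound W) (n : ℤ) {S A : ℝ} (hS : ∀ σ : ℝ, physEnergy ε₀ W n σ ≤ S)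
    (hA : ∫ σ, ‖W (n + 1) σ‖ ≤ A) :
    ∫ s, max (-physFlux ε₀ α W n s) 0 ≤ 2 * fluxConst α * (bigLam ε₀)⁻¹ * S * A := by
  obtain ⟨M, hM⟩ := hW.action
  have hΛ : 0 < bigLam ε₀ := bigLam_pos (by linarith)
  have hS0 : 0 ≤ S := (physEnergy_nonneg _ _ _ _).trans (hS 0)
  have hc0 : 0 ≤ 2 * fluxConst α * (bigLam ε₀)⁻¹ * S := by
    have := fluxConst_nonneg α; positivity
  have hint : Integrable (physFlux ε₀ α W n) := integrable_physFlux hε hc hW hU n hS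
  have hnorm : Integrable (fun σ => ‖W (n + 1) σ‖) := (hM (n + 1)).1
  calc ∫ s, max (-physFlux ε₀ α W n s) 0
      ≤ ∫ s, 2 * fluxConst α * (bigLam ε₀)⁻¹ * S * ‖W (n + 1) s‖ := by
        refine integral_mono hint.neg_part (hnorm.const_mul _) fun s => ?_
        have h := abs_physFlux_le_peak hε hc n hS s
        have h1 : -physFlux ε₀ α W n s ≤ |physFlux ε₀ α W n s| := neg_le_abs _
        have h2 : (0 : ℝ) ≤ 2 * fluxConst α * (bigLam ε₀)⁻¹ * S * ‖W (n + 1) s‖ :=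
          mul_nonneg hc0 (norm_nonneg _)
        exact max_le (h1.trans h) h2
    _ = 2 * fluxConst α * (bigLam ε₀)⁻¹ * S * ∫ s, ‖W (n + 1) s‖ := integral_const_mul _ _
    _ ≤ 2 * fluxConst α * (bigLam ε₀)⁻¹ * S * A := mul_le_mul_of_nonneg_left hA hc0

/-- **Sloshing lift ≤ peak × action.**  The tail above shell `n+1` never exceeds its final value by more than `2C_AΛ⁻¹ · S · A`:
`T_{n+1}(σ) ≤ L (n+1) + 2C_AΛ⁻¹ S A` for every `σ`, whenever `E_n ≤ S` at all log-times and `∫_ℝ ‖W_{n+1}‖ ≤ A`. -/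
theorem tail_le_finalTail_add_peak_action (hε : 0 < ε₀) (hc : IsCancellingCoeff α) (hW : IsEternal ε₀ α W)
    (hU : UniformBound W) (n : ℤ) {L : ℤ → ℝ}
    (hL : ∀ n : ℤ, Tendsto (fun σ => ∑' k : ℕ, physEnergy ε₀ W (n + k) σ) atTop (𝓝 (L n)))
    {S A : ℝ} (hS : ∀ σ : ℝ, physEnergy ε₀ W n σ ≤ S) (hA : ∫ σ, ‖W (n + 1) σ‖ ≤ A) (σ : ℝ) :
    ∑' k : ℕ, physEnergy ε₀ W (n + 1 + k) σ ≤ L (n + 1) + 2 * fluxConst α * (bigLam ε₀)⁻¹ * S * A := by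
  have h1 := tail_le_finalTail_add_backscatter hε hc hW hU (n + 1) hL σ
  rw [add_sub_cancel_right] at h1
  have h2 := backscatter_le_peak_action hε hc hW hU n hS hA
  linarith

/-- **BOTH ledger defects at bond `n` are `≤ 2C_AΛ⁻¹ · M · S`.**  With `M` the uniform action bound of `IsEternal` and `S` a peak
bound of shell `n`: the conveyor mass (energy escaping to `k = +∞`) and the sloshing lift of the tail above `n+1` (energy that enters
the tail and later returns) are each at most `2C_AΛ⁻¹ M S`. -/
theorem ledgerDefects_le_peak_action (hε : 0 < ε₀) (hc : IsCancellingCoeff α) (hW : IsEternal ε₀ α W)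
    (hU : UniformBound W)
    {ω : ℤ → ℝ} (hω : ∀ k : ℤ, Tendsto (physEnergy ε₀ W k) atTop (𝓝 (ω k)))
    {L : ℤ → ℝ} (hL : ∀ n : ℤ, Tendsto (fun σ => ∑' k : ℕ, physEnergy ε₀ W (n + k) σ) atTop (𝓝 (L n)))
    {M : ℝ} (hM : ∀ k : ℤ, ∫ σ, ‖W k σ‖ ≤ M) (n₀ n : ℤ) {S : ℝ} (hS : ∀ σ : ℝ, physEnergy ε₀ W n σ ≤ S) :
    conveyorMass ω L n₀ ≤ 2 * fluxConst α * (bigLam ε₀)⁻¹ * M * S ∧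
      ∀ σ : ℝ, ∑' k : ℕ, physEnergy ε₀ W (n + 1 + k) σ - L (n + 1) ≤ 2 * fluxConst α * (bigLam ε₀)⁻¹ * M * S := by
  refine ⟨?_, fun σ => ?_⟩
  · have h := conveyorMass_le_of_peak hε hc hW hU hω hL hM n₀ n hS
    calc conveyorMass ω L n₀ ≤ 2 * fluxConst α * (bigLam ε₀)⁻¹ * S * M := h
      _ = 2 * fluxConst α * (bigLam ε₀)⁻¹ * M * S := by ring
  · have h := tail_le_finalTail_add_peak_action hε hc hW hU n hL hS (hM (n + 1)) σ
    linarith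

/-- **Fading peaks kill sloshing too (absolutely).**  If along SOME shells the single-shell peaks become arbitrarily small
(g0's residual of `stub_noConveyor`), then for every `δ > 0` there is a shell above which the tail NEVER exceeds its final value by
more than `δ`. -/
theorem sloshing_fade_of_peaks_fade (hε : 0 < ε₀) (hc : IsCancellingCoeff α) (hW : IsEternal ε₀ α W)
    (hU : UniformBound W) {L : ℤ → ℝ}
    (hL : ∀ n : ℤ, Tendsto (fun σ => ∑' k : ℕ, physEnergy ε₀ W (n + k) σ) atTop (𝓝 (L n)))
    (hfade : ∀ δ : ℝ, 0 < δ → ∃ n : ℤ, ∀ σ : ℝ, physEnergy ε₀ W n σ ≤ δ) {δ : ℝ} (hδ : 0 < δ) :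
    ∃ n : ℤ, ∀ σ : ℝ, ∑' k : ℕ, physEnergy ε₀ W (n + 1 + k) σ ≤ L (n + 1) + δ := by
  obtain ⟨M, hM⟩ := hW.action
  have hM0 : 0 ≤ M := le_trans (integral_nonneg fun σ => norm_nonneg _) ((hM 0).2)
  have hΛ : 0 < bigLam ε₀ := bigLam_pos (by linarith)
  set c : ℝ := 2 * fluxConst α * (bigLam ε₀)⁻¹ * M with hcdef
  have hc0 : 0 ≤ c := by have := fluxConst_nonneg α; rw [hcdef]; positivity
  obtain ⟨n, hn⟩ := hfade (δ / (c + 1)) (div_pos hδ (by linarith))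
  refine ⟨n, fun σ => ?_⟩
  have h := tail_le_finalTail_add_peak_action hε hc hW hU n hL hn (hM (n + 1)).2 σ
  have hcd : 2 * fluxConst α * (bigLam ε₀)⁻¹ * (δ / (c + 1)) * M = c * (δ / (c + 1)) := by rw [hcdef]; ring
  have hle : c * (δ / (c + 1)) ≤ δ := by
    rw [mul_div_assoc', div_le_iff₀ (by linarith : (0 : ℝ) < c + 1)]
    nlinarith
  linarith

/-- **`boundedSloshing` (block line, `∃ ℓ`) ⟸ RELATIVE PEAK BOUND.**  If the peak of shell `n` is at most `K` times the energy that
finally settles above it, `E_n(σ) ≤ S ≤ K · L(n+1)`, and `∫_ℝ ‖W_{n+1}‖ ≤ A`, then the tail above `n+1` is bounded by the FIXED multiple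
`1 + 2C_AΛ⁻¹ K A` of its final value at all log-times. -/
theorem boundedSloshing_of_relativePeak (hε : 0 < ε₀) (hc : IsCancellingCoeff α) (hW : IsEternal ε₀ α W)
    (hU : UniformBound W) (n : ℤ) {L : ℤ → ℝ}
    (hL : ∀ n : ℤ, Tendsto (fun σ => ∑' k : ℕ, physEnergy ε₀ W (n + k) σ) atTop (𝓝 (L n)))
    {S A K : ℝ} (hS : ∀ σ : ℝ, physEnergy ε₀ W n σ ≤ S) (hA : ∫ σ, ‖W (n + 1) σ‖ ≤ A)
    (hK : S ≤ K * L (n + 1)) (σ : ℝ) :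
    ∑' k : ℕ, physEnergy ε₀ W (n + 1 + k) σ ≤ (1 + 2 * fluxConst α * (bigLam ε₀)⁻¹ * K * A) * L (n + 1) := by
  have hΛ : 0 < bigLam ε₀ := bigLam_pos (by linarith)
  have hA0 : 0 ≤ A := le_trans (integral_nonneg fun σ => norm_nonneg _) hA
  have hc0 : 0 ≤ 2 * fluxConst α * (bigLam ε₀)⁻¹ * A := by
    have := fluxConst_nonneg α; positivity
  have h := tail_le_finalTail_add_peak_action hε hc hW hU n hL hS hA σ
  have hmono : 2 * fluxConst α * (bigLam ε₀)⁻¹ * S * A ≤ 2 * fluxConst α * (bigLam ε₀)⁻¹ * (K * L (n + 1)) * A := by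
    have := mul_le_mul_of_nonneg_left hK hc0
    nlinarith
  calc ∑' k : ℕ, physEnergy ε₀ W (n + 1 + k) σ
      ≤ L (n + 1) + 2 * fluxConst α * (bigLam ε₀)⁻¹ * S * A := h
    _ ≤ L (n + 1) + 2 * fluxConst α * (bigLam ε₀)⁻¹ * (K * L (n + 1)) * A := by linarith
    _ = (1 + 2 * fluxConst α * (bigLam ε₀)⁻¹ * K * A) * L (n + 1) := by ring

/-- **`stub_noSloshing` ⟸ RELATIVE PEAK BOUND (budget form).**  Under the relative peak bound `S ≤ K · L(n+1)` and the action bound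
`A` on shell `n+1`, the inner inequality of `NoSloshing R γ` at shell `n+1`, `T_{n+1}(σ) ≤ (1+ε₀)^γ · L(n+1)`, holds as soon as
`1 + 2C_AΛ⁻¹ K A ≤ (1+ε₀)^γ`. -/
theorem noSloshing_of_relativePeak (hε : 0 < ε₀) (hc : IsCancellingCoeff α) (hW : IsEternal ε₀ α W)
    (hU : UniformBound W) (n : ℤ) {L : ℤ → ℝ}
    (hL : ∀ n : ℤ, Tendsto (fun σ => ∑' k : ℕ, physEnergy ε₀ W (n + k) σ) atTop (𝓝 (L n)))
    {S A K γ : ℝ} (hS : ∀ σ : ℝ, physEnergy ε₀ W n σ ≤ S) (hA : ∫ σ, ‖W (n + 1) σ‖ ≤ A)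
    (hK : S ≤ K * L (n + 1)) (hγ : 1 + 2 * fluxConst α * (bigLam ε₀)⁻¹ * K * A ≤ (1 + ε₀) ^ γ) (σ : ℝ) :
    ∑' k : ℕ, physEnergy ε₀ W (n + 1 + k) σ ≤ (1 + ε₀) ^ γ * L (n + 1) := by
  have h := boundedSloshing_of_relativePeak hε hc hW hU n hL hS hA hK σ
  have hL0 : 0 ≤ L (n + 1) :=
    ge_of_tendsto' (hL (n + 1)) fun σ => tsum_nonneg fun k => physEnergy_nonneg _ _ _ _
  exact h.trans (mul_le_mul_of_nonneg_right hγ hL0)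

end Summit.NavierStokesRegularity.NavierStokesRegularity.Cruxes.EternalInviscidRate.FinalWakeLedger

end
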